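import Summits.QuantumAdvantage.AdviceFreeQNC0.AffBells26FlipCubeSieve
import HarnessLib

/-!
# Sketch26, part 2 (planner qn-p1 g26, ROUND-25 §5.2, §5.8–§5.15): MOVE SYSTEMS, the move-agnostic cube identity, R-26-circ and the
# DENSITY block — statements

(VERBATIM copy of the tail (lines 222–413) of `HOME/qa-qnc0-p1/exp26/Sketch26.lean` at sha16 `52b8fa951a82bed9` — the part added by the
planner seat qn-p1 g26 after the first 224 lines were landed as `AffBells26FlipCubeSieve.lean` (ask P-26b addendum 2); statements + the
PROVED packaging `noPerfectAffineBells3_of_S26gen`; landed by the prover seat qn-prover-3 g14.  Only this paragraph and two one-line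
docstrings (`survSumF`, `CubeRefutableGenAll`, lint) are new.  Of the earlier part, the planner meanwhile sharpened only the docstring of
`CubeRefutableAll` (creation-only S26: "plausibly FALSE for creation-immune row-lattice supports" — do not spend time on it).)

Contents: `xF`, `MoveSystem`, `dF`, `owners`, `base`, `SurvF`, `DF`, `survSumF`, the typed targets `CubeIdentityGen` (move-agnostic Q1),
`CubeTargetGen`, `CubeRefutableGen`, `CubeRefutableGenAll` (S26-gen, conjecture), `noPerfectAffineBells3_of_S26gen` (PROVED),
`CreationsMoveSystem`, `NoPerfectCirculantBells3` (R-26-circ), and the density block `klineZeros`, `near2`, `footprint`, `cubeTargetSum`,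
`Mismatch`, `LocalCertificate`, `S26LocalBounded`, `ZonePatternCount`, `DensityUpgrade`, `S26LocalLog`, `AffBellsPolyLoss3` (= rung (NP₁)),
`DensityUpgradeLog`.  WHAT THIS IS NOT: statements (prover targets `CubeIdentityGen`, `CubeTargetGen`, `CreationsMoveSystem`,
`ZonePatternCount`, `DensityUpgrade(Log)`); nothing here is load-bearing for the DWalkThree cone; separation NOT moved.
-/

namespace Summit.QuantumAdvantage.AdviceFreeQNC0

namespace AffBells26

open Finset Literature.Computability.QuantumComplexity Literature.Computability.QuantumComplexity.RingHLF
open AffBells23 Fib19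

/-! ## The move-agnostic cube identity (creations, hops `Fib19.kline_hop`, annihilations; ROUND-25 §5.2 "generic moves", exp26d/sieve3.py)

A MOVE SYSTEM at an odd input `x`: `m` moves, move `j` flips the bit set `F j` (positions ACTIVE in `x`) and toggles the activity of
exactly the rows `O j` ("owned" rows: the centre of a creation, the two ends `{k, k+1}` of a hop, the coin of an annihilation), all
these sets pairwise disjoint.  The semantic content (which concrete flip sets ARE move systems) is `Fib19.kline_create`, `kline_hop`
iterated — stated separately (`creations_moveSystem`), so that the identity itself is pure double counting. -/

/-- The input with the moves in `S` applied. -/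
def xF {N m : ℕ} (x : Fin N → Bool) (F : Fin m → Finset (Fin N)) (S : Finset (Fin m)) : Fin N → Bool :=
  flipAt x (S.biUnion F)

/-- Move-system axioms at `x` (see the section docstring). -/
def MoveSystem {N m : ℕ} (x : Fin N → Bool) (F O : Fin m → Finset (Fin N)) : Prop :=
  IsOdd x ∧
  (∀ S : Finset (Fin m), IsOdd (xF x F S) ∧
      ∀ i : Fin N, kline (xF x F S) i = xor (kline x i) (decide (∃ j ∈ S, i ∈ O j))) ∧
  (∀ j j' : Fin m, j ≠ j' → Disjoint (F j) (F j') ∧ Disjoint (O j) (O j')) ∧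
  (∀ j j' : Fin m, Disjoint (F j) (O j')) ∧
  (∀ j : Fin m, ∀ b ∈ F j, kline x b = true)

/-- Drift of row `g` under move `j`: `Σ_{b ∈ F j} β_{g,b} (1 + x_b)`. -/
def dF {N m : ℕ} (β : Fin N → Fin N → ZMod 3) (x : Fin N → Bool) (F : Fin m → Finset (Fin N)) (g : Fin N) (j : Fin m) : ZMod 3 :=
  ∑ b ∈ F j, β g b * (if x b then 2 else 1)

/-- The moves owning row `g` (at most one in a move system). -/
def owners {N m : ℕ} (O : Fin m → Finset (Fin N)) (g : Fin N) : Finset (Fin m) :=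
  univ.filter fun j => g ∈ O j

/-- Base point of row `g`: `x` itself if `g` is active in `x`, else `x` with its owning move applied (the point where `g` IS active). -/
def base {N m : ℕ} (x : Fin N → Bool) (F O : Fin m → Finset (Fin N)) (g : Fin N) : Fin N → Bool :=
  if kline x g = true then x else xF x F (owners O g)

/-- Survivors: rows that are active somewhere on the cube (active in `x` or owned) and SEE every move not owning them. -/
def SurvF {N m : ℕ} (β : Fin N → Fin N → ZMod 3) (x : Fin N → Bool) (F O : Fin m → Finset (Fin N)) : Finset (Fin N) :=
  univ.filter fun g => (kline x g = true ∨ (owners O g).Nonempty) ∧ ∀ j : Fin m, g ∉ O j → dF β x F g j ≠ 0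

/-- Total drift over the non-owning moves. -/
def DF {N m : ℕ} (β : Fin N → Fin N → ZMod 3) (x : Fin N → Bool) (F O : Fin m → Finset (Fin N)) (g : Fin N) : ZMod 3 :=
  ∑ j ∈ univ.filter (fun j => g ∉ O j), dF β x F g j

/-- The survivors' sum of a move system: `Σ_{g ∈ SurvF} (1 + [form β (base g) g = c_g + DF_g])`. -/
def survSumF {N m : ℕ} (β : Fin N → Fin N → ZMod 3) (c : Fin N → ZMod 3) (x : Fin N → Bool) (F O : Fin m → Finset (Fin N)) : ℕ :=
  ∑ g ∈ SurvF β x F O, (1 + if form β (base x F O g) g = c g + DF β x F O g then 1 else 0)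

/-- **Q1-gen (move-agnostic cube identity)** — for every `(β, c)` and every move system with `m ≥ 2` moves.  Proof = the proof of
`CubeIdentity` verbatim: a row not seeing move `j ∌ g` cancels under `S ↦ S △ {j}`; a seeing row is counted by `AffBells24.nSub_mod_two`
over the moves not owning it, from its base point. -/
def CubeIdentityGen : Prop :=
  ∀ N m : ℕ, 5 ≤ N → 2 ≤ m → ∀ (β : Fin N → Fin N → ZMod 3) (c : Fin N → ZMod 3) (x : Fin N → Bool) (F O : Fin m → Finset (Fin N)),
    MoveSystem x F O →
      (∑ S : Finset (Fin m), activeOnes (xF x F S) (affBell β c (xF x F S))) % 2 = survSumF β c x F O % 2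

/-- Target side for move systems whose owned sets do not interact at distance two (then `t = N + Z + pairs2` is affine along the cube). -/
def CubeTargetGen : Prop :=
  ∀ N m : ℕ, 5 ≤ N → 2 ≤ m → ∀ (x : Fin N → Bool) (F O : Fin m → Finset (Fin N)), MoveSystem x F O →
    (∀ j j' : Fin m, j ≠ j' → ∀ u ∈ O j, ∀ v ∈ O j', v ≠ nxt (nxt u) ∧ v ≠ nxt u) →
      (∑ S : Finset (Fin m), (N + zeros (kline (xF x F S)) + pairs2 (kline (xF x F S)))) % 2 = 0

/-- Refutability by general move cubes, and THEOREM S26-gen (the version the data of ROUND-25 §5.3 support: creation-immune lattice supports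
fall to hops / annihilations). -/
def CubeRefutableGen {N : ℕ} (β : Fin N → Fin N → ZMod 3) : Prop :=
  ∀ c : Fin N → ZMod 3, ∃ (m : ℕ) (x : Fin N → Bool) (F O : Fin m → Finset (Fin N)), 2 ≤ m ∧ MoveSystem x F O ∧
    (∀ j j' : Fin m, j ≠ j' → ∀ u ∈ O j, ∀ v ∈ O j', v ≠ nxt (nxt u) ∧ v ≠ nxt u) ∧ survSumF β c x F O % 2 = 1

/-- THEOREM S26-gen (CONJECTURE): every large strategy matrix is refutable by a general move cube.
FALSE as stated (β = 0, `AffBells27LightWitness` — `not_cubeRefutableGenAll` — / Sketch27 §27.1); kept as the shape of the HEAVY-β statement. -/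
def CubeRefutableGenAll : Prop := ∃ N₀ : ℕ, ∀ N ≥ N₀, ∀ β : Fin N → Fin N → ZMod 3, CubeRefutableGen β

/-- (NP₀) from Q0, Q1-gen, the generic target lemma and S26-gen (PROVED packaging). -/
theorem noPerfectAffineBells3_of_S26gen (h0 : TargetFormula) (h1 : CubeIdentityGen) (h2 : CubeTargetGen)
    (hS : CubeRefutableGenAll) : NoPerfectAffineBells3 := by
  obtain ⟨N₀, hN₀⟩ := hS
  refine ⟨max N₀ 5, fun N hN β c => ?_⟩
  have hN5 : 5 ≤ N := le_of_max_le_right hN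
  obtain ⟨m, x, F, O, hm, hMS, hO, hodd⟩ := hN₀ N (le_of_max_le_left hN) β c
  by_contra hcon
  push Not at hcon
  -- every x_S is odd and won: activeOnes + target ≡ 0 pointwise, so the two cube sums agree mod 2
  have hwin : ∀ S : Finset (Fin m),
      (activeOnes (xF x F S) (affBell β c (xF x F S)) + (N + zeros (kline (xF x F S)) + pairs2 (kline (xF x F S)))) % 2 = 0 := by
    intro S
    have hoddS : IsOdd (xF x F S) := (hMS.2.1 S).1
    have hrel : RingHLF.Rel (xF x F S) (affBell β c (xF x F S)) := by
      have := hcon (xF x F S) ((isOdd_iff_oddZeros _).mp hoddS)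
      exact this
    have := (h0 N (by omega) (xF x F S) hoddS (affBell β c (xF x F S))).mp hrel
    omega
  have hsum : (∑ S : Finset (Fin m), (activeOnes (xF x F S) (affBell β c (xF x F S)) +
      (N + zeros (kline (xF x F S)) + pairs2 (kline (xF x F S))))) % 2 = 0 := by
    rw [Finset.sum_nat_mod]
    simp [hwin]
  have h1' := h1 N m hN5 hm β c x F O hMS
  have h2' := h2 N m hN5 hm x F O hMS hO
  rw [Finset.sum_add_distrib] at hsum
  omega

/-- Instance statement (to prove, from `Fib19.kline_create` by induction on `S`): the creations of an admissible `A` form a move system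
with flip sets `{a-1, a+1}` and owned rows `{a}` (moves indexed by `Fin A.card` through `Finset.orderEmbOfFin`).  Hops (`Fib19.kline_hop`:
flips `{k-1, k+2}`, owned `{k, k+1}`, side condition `x k = true`) and annihilations give move systems likewise; mixed families need the
evident separation conditions (exp26d/sieve3.py checks the axioms numerically instead). -/
def CreationsMoveSystem : Prop :=
  ∀ N : ℕ, 4 ≤ N → ∀ (x : Fin N → Bool) (A : Finset (Fin N)), IsOdd x → Admissible x A →
    MoveSystem x (fun j : Fin A.card => ({prv (A.orderEmbOfFin rfl j), nxt (A.orderEmbOfFin rfl j)} : Finset (Fin N)))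
      (fun j => ({A.orderEmbOfFin rfl j} : Finset (Fin N)))

/-! ## R-26-circ (exact data: kit j310372, numpy enumeration of all v ∈ 𝔽₃^N, c ∈ 𝔽₃) -/

/-- **No perfect CIRCULANT affine MOD₃ bell strategy for N ≥ 7** (`β_{k,i} = v_{i-k}`, constant offset `c`).  Exact enumeration:
48 perfect circulants at N = 6 (e.g. v = 000220), NONE for N = 7, 8, …, 18 (j310372, exact; kissat had returned UNKNOWN at 3000 s
for N = 12..16, j309453).  Candidate first infinite-N theorem of the sieve: for a circulant the type word of row g at centre a depends only
on a − g, so the cover / isolation analysis is uniform in g. -/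
def NoPerfectCirculantBells3 : Prop :=
  ∀ N : ℕ, 7 ≤ N → ∀ (v : Fin N → ZMod 3) (c : ZMod 3), ∃ x : Fin N → Bool,
    OddZeros x ∧ ¬ RingHLF.Rel x (affBell (fun k i => v (i - k)) (fun _ => c) x)

/-! ## The DENSITY UPGRADE (ROUND-25 §5.11): bounded LOCAL certificates ⇒ the affine 1−η rung `BondTwist3.RingAffineBellsLt3`

A refuting cube is a LOCAL object: its footprint (base coins, flip sets, owned sets) has bounded size, and every odd input whose
coin pattern agrees with the certificate on the radius-2 neighbourhood of the footprint carries a shifted copy of the same cube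
(coins added at distance ≥ 3 shift each row's form by a constant, which the c-free fibre criterion absorbs; numerically 44/44,
radius 1 fails).  A double count then turns ONE certificate per `β` into `2^{N-1-O(1)}` lost inputs: this is the (G2)-wall lever —
the 1−η regime for affine bells reduces to a bounded perfect-regime existence statement. -/

/-- Coin set (zeros of the kernel line). -/
def klineZeros {N : ℕ} (x : Fin N → Bool) : Finset (Fin N) := univ.filter fun i => kline x i = false

/-- Radius-2 cyclic neighbourhood of a set of positions. -/
def near2 {N : ℕ} (Φ : Finset (Fin N)) : Finset (Fin N) :=
  univ.filter fun i => i ∈ Φ ∨ nxt i ∈ Φ ∨ prv i ∈ Φ ∨ nxt (nxt i) ∈ Φ ∨ prv (prv i) ∈ Φ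

/-- Footprint of a certificate: base coins, flipped bits, owned rows. -/
def footprint {N m : ℕ} (C : Finset (Fin N)) (F O : Fin m → Finset (Fin N)) : Finset (Fin N) :=
  C ∪ univ.biUnion F ∪ univ.biUnion O

/-- Sum over the cube of the target parities `N + Z + pairs2` (cf. `TargetFormula`). -/
def cubeTargetSum {N m : ℕ} (x : Fin N → Bool) (F : Fin m → Finset (Fin N)) : ℕ :=
  ∑ S : Finset (Fin m), (N + zeros (kline (xF x F S)) + pairs2 (kline (xF x F S)))

/-- The cube at `x` MISMATCHES for the strategy `(β, c)`: survivor sum and target sum have different parities (so, by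
`CubeIdentityGen` + `TargetFormula`, some point of the cube is lost). -/
def Mismatch {N m : ℕ} (β : Fin N → Fin N → ZMod 3) (c : Fin N → ZMod 3) (x : Fin N → Bool)
    (F O : Fin m → Finset (Fin N)) : Prop :=
  survSumF β c x F O % 2 ≠ cubeTargetSum x F % 2

/-- A LOCAL CERTIFICATE for `β`: for every offset vector `c` and every odd input whose coin pattern on the radius-2 neighbourhood of the footprint is
exactly `C`, some re-assignment of the coin values ON `C` gives a point where the moves form a move system and the cube mismatches.  (Only the mismatch
point needs the move-system axioms — this admits value-dependent moves such as hops and annihilations.) -/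
def LocalCertificate {N m : ℕ} (β : Fin N → Fin N → ZMod 3) (C : Finset (Fin N)) (F O : Fin m → Finset (Fin N)) : Prop :=
  ∀ c : Fin N → ZMod 3, ∀ x : Fin N → Bool, IsOdd x → klineZeros x ∩ near2 (footprint C F O) = C →
    ∃ x' : Fin N → Bool, IsOdd x' ∧ klineZeros x' = klineZeros x ∧ (∀ i, i ∉ C → x' i = x i) ∧ MoveSystem x' F O ∧ Mismatch β c x' F O

/-- **THEOREM S26-local (CONJECTURE; bounded-footprint, c-free, local form of S26-gen — the form every sieve3/sieve4 certificate has):**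
every strategy matrix admits a local certificate with at most `Z₀` base coins and at most `m₀` moves of flip/owned size ≤ 2.
FALSE as stated (β = 0, `AffBells27LightWitness` / `AffBells27Windows.not_s26LocalBounded'` / Sketch27 §27.1); kept as the shape of the HEAVY-β statement. -/
def S26LocalBounded (Z₀ m₀ : ℕ) : Prop :=
  ∃ N₀ : ℕ, ∀ N ≥ N₀, ∀ β : Fin N → Fin N → ZMod 3,
    ∃ (C : Finset (Fin N)) (m : ℕ) (F O : Fin m → Finset (Fin N)),
      2 ≤ m ∧ m ≤ m₀ ∧ C.card ≤ Z₀ ∧ (∀ j, (F j).card ≤ 2 ∧ (O j).card ≤ 2) ∧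
      (∃ x : Fin N → Bool, IsOdd x ∧ klineZeros x ∩ near2 (footprint C F O) = C) ∧ LocalCertificate β C F O

/-- COUNTING LEMMA (support, fibration surgery `C ↦ (C \ near1 Zone) ∪ C*`): a realisable coin pattern on a set `Zone` is carried by at
least a `2^{-K₀ (|Zone|+1)}` fraction of the odd class, `K₀` an absolute constant (the surgery gives `K₀ ≤ 7`). -/
def ZonePatternCount : Prop :=
  ∃ K₀ : ℕ, ∀ N : ℕ, ∀ Zone Cst : Finset (Fin N),
    (∃ x : Fin N → Bool, IsOdd x ∧ klineZeros x ∩ Zone = Cst) →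
      2 ^ (N - 1) ≤ 2 ^ (K₀ * (Zone.card + 1)) * (univ.filter fun x : Fin N → Bool => IsOdd x ∧ klineZeros x ∩ Zone = Cst).card

/-- **THE DENSITY UPGRADE, bounded form (statement; proof = ROUND-25 §5.11 double count, prover target):** Q1-gen + Q0 + the counting lemma +
S26-local with an `N`-independent footprint give the affine 1−η rung `RingAffineBellsLt3` (θ = 1 − 2^{-(K₀(5Z₀+20m₀+1)+Z₀+m₀)}).  CAUTION (§5.12):
bounded-footprint certificates exist for STRUCTURED β (coherent: one survivor with m = 2 at every N; half-lattice: two) but NOT for dense generic β,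
whose isolation needs m ≈ log_{3/2} N centres (min-survivor scaling N(2/3)^m measured to N = 80) — so `S26LocalBounded Z₀ m₀` is NOT expected to hold
for fixed (Z₀, m₀); the unconditional consequence of the sieve is the logarithmic form below. -/
def DensityUpgrade : Prop :=
  CubeIdentityGen → TargetFormula → ZonePatternCount → ∀ Z₀ m₀ : ℕ, S26LocalBounded Z₀ m₀ → BondTwist3.RingAffineBellsLt3

/-- **THEOREM S26-log (CONJECTURE, the form ALL data support incl. the dense scaling):** every strategy matrix admits a local certificate whose footprint
and number of moves are `O(log N)`.
FALSE as stated (β = 0, `AffBells27LightWitness` / `AffBells27Windows.not_s26LocalLog'` / Sketch27 §27.1); kept as the shape of the HEAVY-β statement. -/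
def S26LocalLog (κ : ℕ) : Prop :=
  ∃ N₀ : ℕ, ∀ N ≥ N₀, ∀ β : Fin N → Fin N → ZMod 3,
    ∃ (C : Finset (Fin N)) (m : ℕ) (F O : Fin m → Finset (Fin N)),
      2 ≤ m ∧ m ≤ κ * Nat.log 2 N ∧ (footprint C F O).card ≤ κ * Nat.log 2 N ∧
      (∃ x : Fin N → Bool, IsOdd x ∧ klineZeros x ∩ near2 (footprint C F O) = C) ∧ LocalCertificate β C F O

/-- **(NP₁) — inverse-polynomial loss density for affine bells** (the rung between `(NP₀)` = one loss and `RingAffineBellsLt3` = a constant fraction):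
every affine MOD₃ bell strategy loses at least a `N^{-e}` fraction of the odd class. -/
def AffBellsPolyLoss3 : Prop :=
  ∃ e n₀ : ℕ, ∀ N ≥ n₀, ∀ (β : Fin N → Fin N → ZMod 3) (c : Fin N → ZMod 3),
    (affWinCard β c : ℝ) ≤ (1 - 1 / (N : ℝ) ^ e) * (2 : ℝ) ^ (N - 1)

/-- **THE DENSITY UPGRADE, logarithmic form (statement; same double count):** losses ≥ 2^{N-1} / (2^{K₀} · N^{(5K₀+1)κ + 1}). -/
def DensityUpgradeLog : Prop :=
  CubeIdentityGen → TargetFormula → ZonePatternCount → ∀ κ : ℕ, S26LocalLog κ → AffBellsPolyLoss3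

end AffBells26

end Summit.QuantumAdvantage.AdviceFreeQNC0
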